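import Summits.SmoothPoincare4.SmoothPoincare4.Theorems.SblfDescentRungOneHelperBottFieldLocal
import Mathlib.Geometry.Manifold.PartitionOfUnity
import HarnessLib

/-!
# A vector field with `W(F) = 2 (F - b)`, `W(β) = 0` on a superlevel set (field layer, part 2)

Helper `helper_bott_field` of stub `helper_sliceGluing_bottRecognition` (fibred Morse–Bott
recognition of the polar tube), line `Sketch`, crux `SblfDescent.RungOne`; part 2 of 2 (the local
lifts are in `SblfDescentRungOneHelperBottFieldLocal.lean`).

(Crux item stmt-SmoothPoincare4-18531; skeleton `Cruxes/RungOne/Lines/Sketch.lean`.)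

Let `X` be a compact smooth `4`-manifold, `F : X → ℝ` and `β : X → ℝ²` smooth, `Σ ⊆ X` closed with
`F = b` on `Σ`, `‖β‖ = 1` on `{a₁ < F}` (`a₁ < a`), such that at every point of `{a ≤ F} ∖ Σ`
the pair `(dF, dβ)` maps onto `ℝ × (β x)ᗮ`, and every point of `Σ` has a Morse–Bott chart
`τ = (s, y)` (`dτ` bijective, `F = b - ‖y‖²`, `β = (cos 2πs, sin 2πs)`).  Then there is a smooth
vector field `W` on `X`, vanishing on `Σ`, with `dF(W) = 2 (F - b)` and `dβ(W) = 0` on `{a ≤ F}`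
(`helper_bott_field`).  Proof: the set of admissible vectors at each point is convex, and
admissible local fields exist about every point (the Euler pull-back near `Σ`, the regular lift on
`{a ≤ F} ∖ Σ`, the zero field below `a`; part 1), so Mathlib's
`exists_contMDiffSection_forall_mem_convex_of_local` (smooth partitions of unity) glues them —
exactly as the coordinate fields are lifted in the proof of Ehresmann's theorem, Bröcker–Jänich
(1982), (8.12).

## References

* Th. Bröcker, K. Jänich, *Introduction to Differential Topology*, CUP 1982, (8.12) (proof).
  [BrockerJanichIDT1982]
-/

set_option linter.dupNamespace false

noncomputable section

open scoped Manifold ContDiff Topology RealInnerProductSpace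
open Set Function Filter Metric Bundle

namespace Summit.SmoothPoincare4.SmoothPoincare4.Cruxes.RungOne.Sketch

-- the fibres of the tangent bundle are the model vector space by definition
set_option backward.isDefEq.respectTransparency false in
/-- **A vector field with `W(F) = 2 (F - b)`, `W(β) = 0` on a superlevel set** (field layer of the
fibred Morse–Bott recognition `helper_sliceGluing_bottRecognition`).  `X` a compact smooth
`4`-manifold, `F`, `β` smooth, `Σ` closed with `F = b` on `Σ`, `a₁ < a`, `‖β‖ = 1` on `{a₁ < F}`,
`(dF, dβ)` onto `ℝ × (β x)ᗮ` at the points of `{a ≤ F} ∖ Σ`, and Morse–Bott charts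
`τ : X ⊇ O → ℝ × ℝ³` about the points of `Σ` (`dτ` bijective, `F = b - ‖pr₂ τ‖²`,
`β = (cos 2π pr₁ τ, sin 2π pr₁ τ)` on `O`).  Then there is a smooth vector field `W` on `X` with
`W = 0` on `Σ` and `dF(W) = 2 (F - b)`, `dβ(W) = 0` on `{a ≤ F}` (local lifts glued by a smooth
partition of unity, the conditions being convex; Bröcker–Jänich 1982, proof of (8.12)).
[cite: BrockerJanichIDT1982, (8.12) (proof)] -/
theorem helper_bott_field : ∀ (X : Type) [TopologicalSpace X] [T2Space X] [CompactSpace X] [ChartedSpace (EuclideanSpace ℝ (Fin 4)) X] [IsManifold (𝓡 4) ∞ X] (F : X → ℝ) (β : X → EuclideanSpace ℝ (Fin 2)) (a₁ a b : ℝ) (S : Set X), ContMDiff (𝓡 4) 𝓘(ℝ, ℝ) ∞ F → ContMDiff (𝓡 4) 𝓘(ℝ, EuclideanSpace ℝ (Fin 2)) ∞ β → IsClosed S → a₁ < a → (∀ x ∈ S, F x = b) → (∀ x, a₁ < F x → ‖β x‖ = 1) → (∀ x, a ≤ F x → x ∉ S → ∀ (r : ℝ) (w : EuclideanSpace ℝ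 (Fin 2)), ⟪w, β x⟫ = 0 → ∃ y : EuclideanSpace ℝ (Fin 4), mfderiv (𝓡 4) 𝓘(ℝ, ℝ) F x y = r ∧ mfderiv (𝓡 4) 𝓘(ℝ, EuclideanSpace ℝ (Fin 2)) β x y = w) → (∀ x₀ ∈ S, ∃ (O : Set X) (τ : X → ℝ × EuclideanSpace ℝ (Fin 3)), IsOpen O ∧ x₀ ∈ O ∧ ContMDiffOn (𝓡 4) 𝓘(ℝ, ℝ × EuclideanSpace ℝ (Fin 3)) ∞ τ O ∧ (∀ x ∈ O, Function.Bijective (mfderiv (𝓡 4) 𝓘(ℝ, ℝ × EuclideanSpace ℝ (Fin 3)) τ x)) ∧ (∀ x ∈ O, F x = b - ‖(τ x).2‖ ^ 2) ∧ (∀ x ∈ O, β x 0 = Real.cos (2 * Real.pi * (τ x).1) ∧ β x 1 = Real.sin (2 * Real.pi * (τ x).1))) → ∃ W : Π x : X, TangentSpace (𝓡 4) x, ContMDiff (𝓡 4) (𝓡 4).tangent ∞ (fun x => (⟨x, W x⟩ : TangentBundle (𝓡 4) X)) ∧ (∀ x ∈ S, W x = 0) ∧ ∀ x, a ≤ F x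 → mfderiv (𝓡 4) 𝓘(ℝ, ℝ) F x (W x) = 2 * (F x - b) ∧ mfderiv (𝓡 4) 𝓘(ℝ, EuclideanSpace ℝ (Fin 2)) β x (W x) = 0 := by
  intro X _ _ _ _ _ F β a₁ a b S hF hβ hS ha₁ hSb hnorm hreg hchart
  -- the admissible vectors at each point: a convex set
  set t : ∀ x : X, Set (TangentSpace (𝓡 4) x) := fun x =>
    {v | (a ≤ F x → BottField.dF F x v = 2 * (F x - b) ∧ BottField.dV β x v = 0) ∧ (x ∈ S → v = 0)}
    with ht
  have htc : ∀ x, Convex ℝ (t x) := by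
    intro x v hv w hw μ ν _ _ hμν
    refine ⟨fun hx => ?_, fun hx => ?_⟩
    · obtain ⟨hv1, hv2⟩ := hv.1 hx
      obtain ⟨hw1, hw2⟩ := hw.1 hx
      refine ⟨?_, ?_⟩
      · have h : BottField.dF F x (μ • v + ν • w) = μ * BottField.dF F x v + ν * BottField.dF F x w := by
          unfold BottField.dF; rw [map_add, map_smul, map_smul]; rfl
        rw [h, hv1, hw1, ← add_mul, hμν, one_mul]
      · have h : BottField.dV β x (μ • v + ν • w) = μ • BottField.dV β x v + ν • BottField.dV β x w := by
          unfold BottField.dV; rw [map_add, map_smul, map_smul]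
        rw [h, hv2, hw2, smul_zero, smul_zero, add_zero]
    · rw [hv.2 hx, hw.2 hx, smul_zero, smul_zero, add_zero]
  -- local admissible fields
  have hloc : ∀ x₀ : X, ∃ U ∈ 𝓝 x₀, ∃ W : Π x : X, TangentSpace (𝓡 4) x,
      ContMDiffOn (𝓡 4) ((𝓡 4).prod 𝓘(ℝ, EuclideanSpace ℝ (Fin 4))) ∞
        (fun x => TotalSpace.mk' (EuclideanSpace ℝ (Fin 4)) x (W x)) U ∧ ∀ y ∈ U, W y ∈ t y := by
    intro x₀
    by_cases hx₀ : x₀ ∈ S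
    · -- near `Σ`: the Euler pull-back
      obtain ⟨O, τ, hO, hx₀O, hτ, hbij, hFτ, hβτ⟩ := hchart x₀ hx₀
      have hβτ' : ∀ x ∈ O, β x = BottField.circ (τ x).1 := fun x hx => by
        obtain ⟨h0, h1⟩ := hβτ x hx
        rw [BottField.eq_comb (β x), h0, h1]
        rfl
      obtain ⟨E, hEs, hE⟩ := BottField.exists_local_lift_euler hO hτ hbij hFτ hβτ'
      refine ⟨O, hO.mem_nhds hx₀O, E, hEs, fun y hy => ⟨fun _ => ⟨(hE y hy).1, (hE y hy).2.1⟩,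
        fun hyS => (hE y hy).2.2 (hSb y hyS)⟩⟩
    · by_cases hx₀a : a ≤ F x₀
      · -- a regular point of `{a ≤ F}`
        obtain ⟨U, hU, W, hWs, hW⟩ := BottField.exists_local_lift_regular (b := b) hF hβ hnorm
          (lt_of_lt_of_le ha₁ hx₀a) (hreg x₀ hx₀a hx₀)
        refine ⟨U ∩ Sᶜ, inter_mem hU (hS.isOpen_compl.mem_nhds hx₀), W, hWs.mono inter_subset_left,
          fun y hy => ⟨fun _ => ⟨(hW y hy.1).1, (hW y hy.1).2⟩, fun hyS => absurd hyS hy.2⟩⟩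
      · -- below `a`: the zero field
        rw [not_le] at hx₀a
        refine ⟨{y | F y < a} ∩ Sᶜ, inter_mem ((isOpen_lt hF.continuous continuous_const).mem_nhds hx₀a)
          (hS.isOpen_compl.mem_nhds hx₀), fun _ => 0, ?_, fun y hy => ⟨fun hya => absurd hya (not_le.2 hy.1),
          fun _ => rfl⟩⟩
        exact (contMDiff_zeroSection ℝ (TangentSpace (𝓡 4) : X → Type)).contMDiffOn
  obtain ⟨s, hs⟩ := exists_contMDiffSection_forall_mem_convex_of_local (n := (⊤ : ℕ∞)) (𝓡 4)
    (fun x => TangentSpace (𝓡 4) x) t htc hloc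
  exact ⟨s, s.contMDiff, fun x hx => (hs x).2 hx, fun x hx => (hs x).1 hx⟩

end Summit.SmoothPoincare4.SmoothPoincare4.Cruxes.RungOne.Sketch

end
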